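import Mathlib
import Summits.PneNP.PneNP.Theorems.ConvexRankGatesConvexGateBlindXorDefs

/-!
# PneNP / ConvexRankGates — `ConvexGateBlind`, line `xor-door-perfect-completeness`:
# the cap on functional lower bounds for the shifted lift (support of `stub_exactLifting`, lead c4)

Registered sub-goal `functional_cap` of crux item stmt-PneNP-10680 (line `xor-door-perfect-completeness`,
open stub `stub_exactLifting : XorDoor.ExactLifting`).

Every lower-bound method for the non-negative rank of a matrix `M` that is a LINEAR FUNCTIONAL TEST —
a functional `Φ` with `Φ(R) ≥ -η` on every admissible rank-one term `R` (`0 ≤ R ≤ M` entrywise),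
whence `rk₊(M) ≥ -Φ(M)/η` (hyperplane separation, rectangle corruption, discrepancy, smooth rectangle
bounds are all of this form) — is capped on the matrices of `stub_exactLifting`.  For a matrix `N ≥ J`
(entries `≥ 1`, as `lift_t(viol_F)` of an unsatisfiable `F`) with non-negative factorisations
`N = ∑_{l<r₀} u₀_l ⊗ v₀_l` and `N - J = ∑_{l<r₁} u₁_l ⊗ v₁_l`, and for every `ε ∈ [0,1]`:

  `N - εJ = ∑_l (1-ε) u₀_l ⊗ v₀_l + ∑_l ε · (u₁_l ⊗ v₁_l)`,

every term is admissible for `N - εJ`, and the second family is `ε` times admissible terms, so by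
linearity `-Φ(N - εJ) ≤ η · (r₀ + ε · r₁)` (`functional_cap`): a functional test certifies at most
`rk₊(N) + ε · rk₊(N - J)` — on the Index-lift of `viol_F` at most `#F·t³ + ε · rk₊(lift_t(viol_F) - J)`,
which tends to the rank corner as `ε → 0⁺`.  Hence the `∀ ε > 0` lower bound asked by
`stub_exactLifting` cannot come from any such test (lead c3's "continuity meta-obstacle", made exact);
it needs an invariant that jumps at the support, such as the rectangle/cover bound of
`…ExactLiftingIndexRectangles.lean`, which however only sees the level `ε = 1`.

The statement is generic (any finite row/column types); no definitions.
-/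

set_option linter.dupNamespace false -- `Summit.PneNP.PneNP.…`: summit = sub-problem (D-0017)

namespace Summit.PneNP.PneNP.Theorems.XorDoor

open scoped BigOperators
open Finset

noncomputable section

namespace FunctionalCap

/-- **The cap** (registered by name as `functional_cap` below).  Let `N` have entries `≥ 1`, with
non-negative factorisations `N = ∑_{l<r₀} u₀_l ⊗ v₀_l` and `N - J = ∑_{l<r₁} u₁_l ⊗ v₁_l`, let
`0 ≤ ε ≤ 1`, and let `Φ` be a linear functional with `Φ(u ⊗ v) ≥ -η` for every non-negative rank-one
`u ⊗ v ≤ N - εJ`.  Then `-Φ(N - εJ) ≤ η (r₀ + ε r₁)`: a functional test certifies a non-negative rank of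
`N - εJ` of at most `r₀ + ε r₁`. -/
theorem cap {α β : Type} [Fintype α] [Fintype β]
    (N : α → β → ℝ) (hN : ∀ a b, 1 ≤ N a b) {ε : ℝ} (hε0 : 0 ≤ ε) (hε1 : ε ≤ 1)
    {r₀ : ℕ} (u₀ : Fin r₀ → α → ℝ) (v₀ : Fin r₀ → β → ℝ)
    (hu₀ : ∀ l a, 0 ≤ u₀ l a) (hv₀ : ∀ l b, 0 ≤ v₀ l b)
    (hN₀ : ∀ a b, N a b = ∑ l, u₀ l a * v₀ l b)
    {r₁ : ℕ} (u₁ : Fin r₁ → α → ℝ) (v₁ : Fin r₁ → β → ℝ)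
    (hu₁ : ∀ l a, 0 ≤ u₁ l a) (hv₁ : ∀ l b, 0 ≤ v₁ l b)
    (hN₁ : ∀ a b, N a b - 1 = ∑ l, u₁ l a * v₁ l b)
    (Φ : (α → β → ℝ) →ₗ[ℝ] ℝ) {η : ℝ}
    (hΦ : ∀ (u : α → ℝ) (v : β → ℝ), (∀ a, 0 ≤ u a) → (∀ b, 0 ≤ v b) →
      (∀ a b, u a * v b ≤ N a b - ε) → -η ≤ Φ (fun a b => u a * v b)) :
    -Φ (fun a b => N a b - ε) ≤ η * (r₀ + ε * r₁) := by
  -- the decomposition of `N - εJ` into admissible rank-one terms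
  have hdec : (fun a b => N a b - ε)
      = (∑ l : Fin r₀, fun a b => ((1 - ε) * u₀ l a) * v₀ l b)
        + ∑ l : Fin r₁, ε • (fun a b => u₁ l a * v₁ l b) := by
    funext a b
    simp only [Pi.add_apply, Finset.sum_apply, Pi.smul_apply, smul_eq_mul]
    have h0 := hN₀ a b
    have h1 := hN₁ a b
    have e0 : ∑ l : Fin r₀, (1 - ε) * u₀ l a * v₀ l b = (1 - ε) * N a b := by
      rw [h0, Finset.mul_sum]; refine Finset.sum_congr rfl fun l _ => ?_; ring
    have e1 : ∑ l : Fin r₁, ε * (u₁ l a * v₁ l b) = ε * (N a b - 1) := by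
      rw [h1, Finset.mul_sum]
    rw [e0, e1]; ring
  -- single terms are dominated by the full sums
  have hle₀ : ∀ l a b, u₀ l a * v₀ l b ≤ N a b := fun l a b => by
    rw [hN₀ a b]
    exact Finset.single_le_sum (fun l' _ => mul_nonneg (hu₀ l' a) (hv₀ l' b)) (Finset.mem_univ l)
  have hle₁ : ∀ l a b, u₁ l a * v₁ l b ≤ N a b - 1 := fun l a b => by
    rw [hN₁ a b]
    exact Finset.single_le_sum (fun l' _ => mul_nonneg (hu₁ l' a) (hv₁ l' b)) (Finset.mem_univ l)
  -- admissibility of the two families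
  have hadm₀ : ∀ l, -η ≤ Φ (fun a b => ((1 - ε) * u₀ l a) * v₀ l b) := fun l =>
    hΦ (fun a => (1 - ε) * u₀ l a) (v₀ l) (fun a => mul_nonneg (by linarith) (hu₀ l a)) (hv₀ l)
      fun a b => by
        have h1 := hle₀ l a b
        have h2 := hN a b
        nlinarith [mul_nonneg (hu₀ l a) (hv₀ l b)]
  have hadm₁ : ∀ l, -η ≤ Φ (fun a b => u₁ l a * v₁ l b) := fun l =>
    hΦ (u₁ l) (v₁ l) (hu₁ l) (hv₁ l) fun a b => by
      have h1 := hle₁ l a b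
      linarith
  -- linearity
  rw [hdec, map_add, map_sum, map_sum]
  have hs₀ : -(η * r₀) ≤ ∑ l : Fin r₀, Φ (fun a b => ((1 - ε) * u₀ l a) * v₀ l b) := by
    calc -(η * r₀) = ∑ _l : Fin r₀, (-η) := by simp [Finset.sum_const, mul_comm]
      _ ≤ _ := Finset.sum_le_sum fun l _ => hadm₀ l
  have hs₁ : -(η * (ε * r₁)) ≤ ∑ l : Fin r₁, Φ (ε • fun a b => u₁ l a * v₁ l b) := by
    calc -(η * (ε * r₁)) = ∑ _l : Fin r₁, ε * (-η) := by
          simp [Finset.sum_const]; ring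
      _ ≤ _ := Finset.sum_le_sum fun l _ => by
          rw [map_smul, smul_eq_mul]
          exact mul_le_mul_of_nonneg_left (hadm₁ l) hε0
  linarith

/-- **The cap, read as a bound on what functional tests can certify for the stub.**  If a functional
test `Φ` (as in `cap`) certifies `s ≤ -Φ(N - εJ)/η` — the way every hyperplane-type lower
bound `rk₊(N - εJ) ≥ s` is obtained — then `s ≤ r₀ + ε r₁` for ANY non-negative factorisations of `N`
(`r₀` terms) and of `N - J` (`r₁` terms).  On `N = lift_t(viol_F)` (`r₀ ≤ #F t³`): at most
`#F t³ + ε · rk₊(N - J)`, i.e. the rank corner as `ε → 0⁺`. -/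
theorem test_le {α β : Type} [Fintype α] [Fintype β]
    (N : α → β → ℝ) (hN : ∀ a b, 1 ≤ N a b) {ε : ℝ} (hε0 : 0 ≤ ε) (hε1 : ε ≤ 1)
    {r₀ : ℕ} (u₀ : Fin r₀ → α → ℝ) (v₀ : Fin r₀ → β → ℝ)
    (hu₀ : ∀ l a, 0 ≤ u₀ l a) (hv₀ : ∀ l b, 0 ≤ v₀ l b)
    (hN₀ : ∀ a b, N a b = ∑ l, u₀ l a * v₀ l b)
    {r₁ : ℕ} (u₁ : Fin r₁ → α → ℝ) (v₁ : Fin r₁ → β → ℝ)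
    (hu₁ : ∀ l a, 0 ≤ u₁ l a) (hv₁ : ∀ l b, 0 ≤ v₁ l b)
    (hN₁ : ∀ a b, N a b - 1 = ∑ l, u₁ l a * v₁ l b)
    (Φ : (α → β → ℝ) →ₗ[ℝ] ℝ) {η : ℝ} (hη : 0 < η)
    (hΦ : ∀ (u : α → ℝ) (v : β → ℝ), (∀ a, 0 ≤ u a) → (∀ b, 0 ≤ v b) →
      (∀ a b, u a * v b ≤ N a b - ε) → -η ≤ Φ (fun a b => u a * v b))
    {s : ℝ} (hs : s * η ≤ -Φ (fun a b => N a b - ε)) :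
    s ≤ r₀ + ε * r₁ := by
  have h := cap N hN hε0 hε1 u₀ v₀ hu₀ hv₀ hN₀ u₁ v₁ hu₁ hv₁ hN₁ Φ hΦ
  have : s * η ≤ η * (r₀ + ε * r₁) := hs.trans h
  nlinarith

end FunctionalCap

/-- **Registered sub-goal `functional_cap` of stmt-PneNP-10680** (by name; proved as `FunctionalCap.cap`):
for `N ≥ J` with non-negative factorisations of `N` (`r₀` terms) and `N - J` (`r₁` terms), `ε ∈ [0,1]`,
and a linear functional `Φ ≥ -η` on the admissible rank-one terms of `N - εJ`:
`-Φ(N - εJ) ≤ η (r₀ + ε r₁)`. -/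
theorem functional_cap : ∀ {α β : Type} [Fintype α] [Fintype β] (N : α → β → ℝ), (∀ a b, 1 ≤ N a b) → ∀ {ε : ℝ}, 0 ≤ ε → ε ≤ 1 → ∀ {r₀ : ℕ} (u₀ : Fin r₀ → α → ℝ) (v₀ : Fin r₀ → β → ℝ), (∀ l a, 0 ≤ u₀ l a) → (∀ l b, 0 ≤ v₀ l b) → (∀ a b, N a b = ∑ l, u₀ l a * v₀ l b) → ∀ {r₁ : ℕ} (u₁ : Fin r₁ → α → ℝ) (v₁ : Fin r₁ → β → ℝ), (∀ l a, 0 ≤ u₁ l a) → (∀ l b, 0 ≤ v₁ l b) → (∀ a b, N a b - 1 = ∑ l, u₁ l a * v₁ l b) → ∀ (Φ : (α → β → ℝ) →ₗ[ℝ] ℝ) {η : ℝ}, (∀ (u : α → ℝ) (v : β → ℝ), (∀ a, 0 ≤ u a) → (∀ b, 0 ≤ v b) → (∀ a b, u a * v b ≤ N a b - ε) → -η ≤ Φ (fun a b => u a * v b)) → -Φ (fun a b => N a b - ε) ≤ η * (r₀ + ε * r₁) :=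
  fun N hN _ hε0 hε1 _ u₀ v₀ hu₀ hv₀ hN₀ _ u₁ v₁ hu₁ hv₁ hN₁ Φ _ hΦ =>
    FunctionalCap.cap N hN hε0 hε1 u₀ v₀ hu₀ hv₀ hN₀ u₁ v₁ hu₁ hv₁ hN₁ Φ hΦ

end

end Summit.PneNP.PneNP.Theorems.XorDoor
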